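import Summits.QuantumFields.YangMills.Theorems.OnsetSkewLawOnsetVanishing
import HarnessLib

/-!
# A priori bounds for the on-torus covariance of two single-plane plaquette fields (leaf 19868, LINE «OctaveDoubling», stubs D1 ∕ D2)

The two open D-stubs of the registered skeleton `Cruxes/HypercubicOSDataFromInfiniteVolume/Lines/octave_doubling.lean` REV 2.1
(D1 `PinnedTopOctaveCeiling`, D2 `PinnedOctaveStep`) are statements about ONE quantity: the centred mixed second moment
`c_{q,k}(t) = E_L[(P^q_{t e_k} − E_L P^q_{t e_k}) (P^q_0 − E_L P^q_0)]` of two single-plane plaquette fields `P^q_x = Re tr r.ρ(U_{x,q})`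
under Wilson's measure on the odd torus of side `2L+1` (`torusE`, `plane` of the tree's `DlrCollarTransfer` vocabulary).

This file records what is known about `c` A PRIORI, i.e. without any input of wall class:

* `abs_torusCov_plane_le_deficit` — for ANY `β`, `L`, orientations and sites,
  `|E_L[(P − E_L P)(P' − E_L P')]| ≤ 2N · (N − E_L P')`: the covariance is controlled by the plaquette DEFICIT `N − ⟨P'⟩`
  (pointwise `0 ≤ N − P ≤ 2N`, so the mixed moment about `N` and the product of the deficits are both in `[0, 2N(N − ⟨P'⟩)]`);
* `abs_torusCov_plane_le_sq` — hence `|c| ≤ 4N²` always;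
* `torus_plane_deficit_le` — the deficit is `≤ N·η` for `β ≥ β₀(η)`, uniformly in the torus, the orientation and the site
  (the tree's weak-coupling plaquette floor `wilsonExpectation_plaquette_ge_one_sub_of_weakCoupling`, Montvay–Münster (3.113));
* `abs_torusCov_plane_le_of_weakCoupling` — so **`|c_{q,k}(t)| ≤ 2N²η` for `β ≥ β₀(η)`, uniformly in `L`, `q`, `k`, `t`**:
  plaquette-field covariances VANISH uniformly at weak coupling.

Consequences for the line (see `Theorems/InfiniteVolumeContinuumOctaveDoublingReductions.lean`): D1 and D2 hold for free on
every BOUNDED range of `R` (their content is at `R → ∞`, i.e. at sub-unit physical scales `R s ≤ ℓ₄` with the pinned onset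
scale `s → 0`), and the onset floors of level `ε` cannot sit at a scale bounded below as `β → ∞`.

HONEST LABEL: elementary a priori estimates (bounded observables + the weak-coupling plaquette floor); they prove no stub of
wall class, no crux, rung, leaf or summit; the Yang–Mills mass gap is NOT proved.  Prover seat `ymfull-r2a-prover-2` g0
(R590-ym item (14)), 2026-08-30.
-/

set_option autoImplicit false

noncomputable section

open scoped BigOperators
open MeasureTheory Filter Topology
open Literature.MathematicalPhysics.QuantumFieldTheory Literature.MathematicalPhysics.QuantumLattice
open Literature.Probability.LatticeModels (Site)
open Summit.QuantumFields.YangMills.Cruxes.OSLegsFromFemtoAndGap.DlrCollarTransfer (torusE plane)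
open Summit.QuantumFields.YangMills.Theorems.OSLegsFromFemtoAndGap (measurable_plane_lift integrable_plane_lift)
open Summit.QuantumFields.YangMills.Theorems.OnsetSkewLawGlue (abs_plane_le_N torusE_plane_eq)

namespace Summit.QuantumFields.YangMills.Theorems.InfiniteVolumeContinuum.PlaneCovariance

variable {G : Type} [Group G] [TopologicalSpace G] [IsTopologicalGroup G] [CompactSpace G]
  [MeasurableSpace G] [BorelSpace G]

/-! ## 1. Pointwise facts about the plane field read through the periodic lift -/

omit [BorelSpace G] in
/-- `0 ≤ N − P` pointwise. [folklore] -/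
theorem deficit_nonneg (r : LatticeRep G) (q : Fin 4 × Fin 4) (x : Site 4) (U : LGConfig 4 G) :
    0 ≤ (r.N : ℝ) - plane G r q x U := by
  have h := abs_plane_le_N r q x U
  rw [abs_le] at h
  linarith [h.2]

omit [BorelSpace G] in
/-- `N − P ≤ 2N` pointwise. [folklore] -/
theorem deficit_le_two_mul (r : LatticeRep G) (q : Fin 4 × Fin 4) (x : Site 4) (U : LGConfig 4 G) :
    (r.N : ℝ) - plane G r q x U ≤ 2 * r.N := by
  have h := abs_plane_le_N r q x U
  rw [abs_le] at h
  linarith [h.1]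

/-- The deficit `N − P` read through the lift is integrable for Wilson's measure on the torus of side `2L+1`. -/
theorem integrable_deficit_lift (r : LatticeRep G) (β : ℝ) (L : ℕ) (q : Fin 4 × Fin 4) (x : Site 4) :
    Integrable (fun U : GaugeConfig 4 (2 * L + 1) G => (r.N : ℝ) - plane G r q x (torusLift (2 * L + 1) U))
      (wilsonMeasure (d := 4) (L := 2 * L + 1) r.ρ β) := by
  haveI := isProbabilityMeasure_wilsonMeasure (d := 4) (L := 2 * L + 1) r.ρ r.continuous β
  exact (integrable_const _).sub (integrable_plane_lift r β L q x)

/-- The product of two deficits read through the lift is integrable (bounded by `4N²`, measurable). -/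
theorem integrable_deficit_mul_lift (r : LatticeRep G) (β : ℝ) (L : ℕ) (q q' : Fin 4 × Fin 4) (x y : Site 4) :
    Integrable (fun U : GaugeConfig 4 (2 * L + 1) G =>
        ((r.N : ℝ) - plane G r q x (torusLift (2 * L + 1) U)) *
          ((r.N : ℝ) - plane G r q' y (torusLift (2 * L + 1) U)))
      (wilsonMeasure (d := 4) (L := 2 * L + 1) r.ρ β) := by
  haveI := isProbabilityMeasure_wilsonMeasure (d := 4) (L := 2 * L + 1) r.ρ r.continuous β
  refine Integrable.of_bound (C := 2 * r.N * (2 * r.N))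
    ((measurable_const.sub (measurable_plane_lift r L q x)).mul
      (measurable_const.sub (measurable_plane_lift r L q' y))).aestronglyMeasurable ?_
  refine Eventually.of_forall fun U => ?_
  rw [Real.norm_eq_abs, abs_mul, abs_of_nonneg (deficit_nonneg r q x _), abs_of_nonneg (deficit_nonneg r q' y _)]
  exact mul_le_mul (deficit_le_two_mul r q x _) (deficit_le_two_mul r q' y _) (deficit_nonneg r q' y _)
    (by positivity)

/-! ## 2. The covariance is controlled by the plaquette deficit -/

/-- The torus mean of the deficit is the deficit of the torus mean: `E_L[N − P] = N − E_L P`. -/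
theorem torusE_deficit (r : LatticeRep G) (β : ℝ) (L : ℕ) (q : Fin 4 × Fin 4) (x : Site 4) :
    torusE G r β L (fun U => (r.N : ℝ) - plane G r q x U) = r.N - torusE G r β L (plane G r q x) := by
  haveI := isProbabilityMeasure_wilsonMeasure (d := 4) (L := 2 * L + 1) r.ρ r.continuous β
  unfold torusE
  rw [integral_sub (integrable_const _) (integrable_plane_lift r β L q x), integral_const, probReal_univ, one_smul]

/-- The deficit of the torus mean is non-negative: `E_L P ≤ N`. -/
theorem torusE_plane_le_N (r : LatticeRep G) (β : ℝ) (L : ℕ) (q : Fin 4 × Fin 4) (x : Site 4) :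
    torusE G r β L (plane G r q x) ≤ r.N := by
  have h : 0 ≤ torusE G r β L (fun U => (r.N : ℝ) - plane G r q x U) := by
    unfold torusE
    exact integral_nonneg fun U => deficit_nonneg r q x _
  rw [torusE_deficit] at h
  linarith

/-- **Covariance ≤ deficit.**  For every `β`, every odd torus, all orientations `q, q'` and sites `x, y`:
`|E_L[(P^q_x − E_L P^q_x)(P^{q'}_y − E_L P^{q'}_y)]| ≤ 2N · (N − E_L P^{q'}_y)`.
Proof: with `a := N − E P`, `b := N − E P'`, the covariance equals `E[(N−P)(N−P')] − ab`; both terms lie in `[0, 2N·b]`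
because `0 ≤ N − P ≤ 2N` pointwise. [folklore] -/
theorem abs_torusCov_plane_le_deficit (r : LatticeRep G) (β : ℝ) (L : ℕ) (q q' : Fin 4 × Fin 4) (x y : Site 4) :
    |torusE G r β L (fun U =>
        (plane G r q x U - torusE G r β L (plane G r q x)) * (plane G r q' y U - torusE G r β L (plane G r q' y)))| ≤
      2 * r.N * ((r.N : ℝ) - torusE G r β L (plane G r q' y)) := by
  haveI := isProbabilityMeasure_wilsonMeasure (d := 4) (L := 2 * L + 1) r.ρ r.continuous β
  set mX := torusE G r β L (plane G r q x) with hmX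
  set mY := torusE G r β L (plane G r q' y) with hmY
  set a : ℝ := (r.N : ℝ) - mX with ha
  set b : ℝ := (r.N : ℝ) - mY with hb
  have ha0 : 0 ≤ a := by rw [ha]; linarith [torusE_plane_le_N r β L q x]
  have hb0 : 0 ≤ b := by rw [hb]; linarith [torusE_plane_le_N r β L q' y]
  have ha2 : a ≤ 2 * r.N := by
    rw [ha, hmX, ← torusE_deficit]
    unfold torusE
    have h := integral_mono (integrable_deficit_lift r β L q x) (integrable_const (2 * (r.N : ℝ)))
      (fun U => deficit_le_two_mul r q x _)
    simpa [integral_const, probReal_univ] using h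
  -- the mixed moment about `N`
  set P : ℝ := torusE G r β L (fun U => ((r.N : ℝ) - plane G r q x U) * ((r.N : ℝ) - plane G r q' y U)) with hP
  have hP0 : 0 ≤ P := by
    rw [hP]; unfold torusE
    exact integral_nonneg fun U => mul_nonneg (deficit_nonneg r q x _) (deficit_nonneg r q' y _)
  have hPb : P ≤ 2 * r.N * b := by
    have hEb : torusE G r β L (fun U => 2 * (r.N : ℝ) * ((r.N : ℝ) - plane G r q' y U)) = 2 * r.N * b := by
      rw [hb, hmY, ← torusE_deficit]
      unfold torusE
      rw [← integral_const_mul]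
    rw [hP, ← hEb]
    unfold torusE
    refine integral_mono (integrable_deficit_mul_lift r β L q q' x y)
      ((integrable_deficit_lift r β L q' y).const_mul _) fun U => ?_
    exact mul_le_mul_of_nonneg_right (deficit_le_two_mul r q x _) (deficit_nonneg r q' y _)
  -- the covariance is `P − a b`
  have hcov : torusE G r β L (fun U => (plane G r q x U - mX) * (plane G r q' y U - mY)) = P - a * b := by
    have hfun : (fun U : LGConfig 4 G => (plane G r q x U - mX) * (plane G r q' y U - mY)) =
        fun U => ((r.N : ℝ) - plane G r q x U) * ((r.N : ℝ) - plane G r q' y U) -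
          (a * ((r.N : ℝ) - plane G r q' y U) + b * ((r.N : ℝ) - plane G r q x U)) + a * b := by
      funext U; rw [ha, hb]; ring
    rw [hfun, hP]
    unfold torusE
    rw [integral_add _ (integrable_const _), integral_sub (integrable_deficit_mul_lift r β L q q' x y),
      integral_add ((integrable_deficit_lift r β L q' y).const_mul _) ((integrable_deficit_lift r β L q x).const_mul _),
      integral_const_mul, integral_const_mul, integral_const, probReal_univ, one_smul]
    · have hEY : ∫ U, (r.N : ℝ) - plane G r q' y (torusLift (2 * L + 1) U) ∂wilsonMeasure (d := 4) (L := 2 * L + 1) r.ρ β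
          = b := by
        rw [hb, hmY, ← torusE_deficit]; rfl
      have hEX : ∫ U, (r.N : ℝ) - plane G r q x (torusLift (2 * L + 1) U) ∂wilsonMeasure (d := 4) (L := 2 * L + 1) r.ρ β
          = a := by
        rw [ha, hmX, ← torusE_deficit]; rfl
      rw [hEY, hEX]; ring
    · exact ((integrable_deficit_lift r β L q' y).const_mul _).add ((integrable_deficit_lift r β L q x).const_mul _)
    · exact (integrable_deficit_mul_lift r β L q q' x y).sub
        (((integrable_deficit_lift r β L q' y).const_mul _).add ((integrable_deficit_lift r β L q x).const_mul _))
  rw [hcov, abs_le]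
  constructor
  · have hab : a * b ≤ 2 * r.N * b := mul_le_mul_of_nonneg_right ha2 hb0
    linarith
  · have hab : 0 ≤ a * b := mul_nonneg ha0 hb0
    linarith

/-- **`|c| ≤ 4N²` always** (the deficit is at most `2N`). [folklore] -/
theorem abs_torusCov_plane_le_sq (r : LatticeRep G) (β : ℝ) (L : ℕ) (q q' : Fin 4 × Fin 4) (x y : Site 4) :
    |torusE G r β L (fun U =>
        (plane G r q x U - torusE G r β L (plane G r q x)) * (plane G r q' y U - torusE G r β L (plane G r q' y)))| ≤
      4 * (r.N : ℝ) ^ 2 := by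
  refine (abs_torusCov_plane_le_deficit r β L q q' x y).trans ?_
  have h : (r.N : ℝ) - torusE G r β L (plane G r q' y) ≤ 2 * r.N := by
    rw [← torusE_deficit]
    haveI := isProbabilityMeasure_wilsonMeasure (d := 4) (L := 2 * L + 1) r.ρ r.continuous β
    unfold torusE
    have h := integral_mono (integrable_deficit_lift r β L q' y) (integrable_const (2 * (r.N : ℝ)))
      (fun U => deficit_le_two_mul r q' y _)
    simpa [integral_const, probReal_univ] using h
  nlinarith [h, (Nat.cast_nonneg r.N : (0 : ℝ) ≤ r.N)]

/-! ## 3. The plaquette deficit vanishes at weak coupling, uniformly in the torus -/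

/-- **Torus plaquette deficit at weak coupling.**  For every `η > 0` there is `β₀` such that for all `β ≥ β₀`, every odd
torus `2L+1`, every orientation `q.1 ≠ q.2` and every site `x`: `N − E_L P^q_x ≤ N·η`
(the tree's `wilsonExpectation_plaquette_ge_one_sub_of_weakCoupling`, Montvay–Münster (3.113), read through
`OnsetSkewLawGlue.torusE_plane_eq`; the torus-side half of `OnsetSkewLawGlue.integral_deficit_le`). [folklore] -/
theorem torus_plane_deficit_le (r : LatticeRep G) {η : ℝ} (hη : 0 < η) :
    ∃ β₀ : ℝ, ∀ β : ℝ, β₀ ≤ β → ∀ (L : ℕ) (q : Fin 4 × Fin 4), q.1 ≠ q.2 → ∀ x : Site 4,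
      (r.N : ℝ) - torusE G r β L (plane G r q x) ≤ r.N * η := by
  by_cases hN : r.N = 0
  · refine ⟨0, fun β _ L q _ x => ?_⟩
    have h0 : ∀ U, plane G r q x U = 0 := fun U => by
      have h := abs_plane_le_N r q x U
      rw [hN, Nat.cast_zero, abs_nonpos_iff] at h
      exact h
    have hE : torusE G r β L (plane G r q x) = 0 := by
      unfold torusE; simp [h0]
    rw [hE, hN]; simp
  · have hN1 : 1 ≤ r.N := Nat.one_le_iff_ne_zero.mpr hN
    have hN0 : (0 : ℝ) < r.N := by exact_mod_cast hN1
    obtain ⟨β₀, _, hβ₀⟩ := wilsonExpectation_plaquette_ge_one_sub_of_weakCoupling (d := 4) (G := G) r.ρ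
      (by norm_num) hN1 r.continuous r.mem_unitary hη
    refine ⟨β₀, fun β hβ L q hq x => ?_⟩
    haveI : NeZero (2 * L + 1) := ⟨by omega⟩
    have h := hβ₀ β hβ (2 * L + 1) (Literature.Probability.LatticeModels.Torus.proj (2 * L + 1) 0) q.1 q.2 hq
    rw [torusE_plane_eq]
    have hlin : wilsonExpectation (L := 2 * L + 1) r.ρ β (fun U : GaugeConfig 4 (2 * L + 1) G =>
        (r.ρ (plaquetteHolonomy U (Literature.Probability.LatticeModels.Torus.proj (2 * L + 1) 0) q.1 q.2)).trace.re) =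
        r.N * wilsonExpectation (L := 2 * L + 1) r.ρ β (fun U : GaugeConfig 4 (2 * L + 1) G =>
          ((r.N : ℝ))⁻¹ * (r.ρ (plaquetteHolonomy U (Literature.Probability.LatticeModels.Torus.proj (2 * L + 1) 0)
            q.1 q.2)).trace.re) := by
      unfold wilsonExpectation
      rw [integral_const_mul, ← mul_assoc, mul_inv_cancel₀ hN0.ne', one_mul]
    rw [hlin]
    have := mul_le_mul_of_nonneg_left h hN0.le
    nlinarith

/-- **Plaquette-field covariances vanish uniformly at weak coupling.**  For every `η > 0` there is `β₀` such that for
all `β ≥ β₀`, every odd torus, all orientations `q` (any) and `q'` with `q'.1 ≠ q'.2`, and all sites: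
`|E_L[(P^q_x − E P^q_x)(P^{q'}_y − E P^{q'}_y)]| ≤ 2N²·η`.  In particular the on-axis mirror covariance `c_{q,k}(t)` of the
D-stubs of LINE «OctaveDoubling» is `≤ 2N²η` uniformly in `L`, `k`, `t`. [folklore] -/
theorem abs_torusCov_plane_le_of_weakCoupling (r : LatticeRep G) {η : ℝ} (hη : 0 < η) :
    ∃ β₀ : ℝ, ∀ β : ℝ, β₀ ≤ β → ∀ (L : ℕ) (q q' : Fin 4 × Fin 4), q'.1 ≠ q'.2 → ∀ x y : Site 4,
      |torusE G r β L (fun U =>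
          (plane G r q x U - torusE G r β L (plane G r q x)) * (plane G r q' y U - torusE G r β L (plane G r q' y)))| ≤
        2 * (r.N : ℝ) ^ 2 * η := by
  obtain ⟨β₀, hβ₀⟩ := torus_plane_deficit_le (G := G) r hη
  refine ⟨β₀, fun β hβ L q q' hq' x y => (abs_torusCov_plane_le_deficit r β L q q' x y).trans ?_⟩
  have h := hβ₀ β hβ L q' hq' y
  have hN : (0 : ℝ) ≤ r.N := Nat.cast_nonneg _
  nlinarith

end Summit.QuantumFields.YangMills.Theorems.InfiniteVolumeContinuum.PlaneCovariance

end
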